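import Literature.MathematicalPhysics.QuantumFieldTheory.Balaban1983to89.B9Eq3132TentFlat

/-!
# `Balaban1983to89.B9Eq3132TentKinetic` — T. Bałaban, *Propagators for lattice gauge theories in a background field*, Commun. Math. Phys. **99** (1985) 389–434
# [Balaban1985BackgroundPropagators], (3.4)∕(3.8) pp. 391–392 with (3.40) p. 397 and [Balaban1984PropagatorsII] (2.147) p. 248: THE KINETIC QUANTITIES OF ONE
# TRANSPORTED TENT — `Σ_p HS((D_UA)(p))`, `Σ_x HS((D\*_UA)(x))` and the curvature-weighted edge mass are bounded by the FLAT gradient energy of the profile, plus the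
# profile's mass times the square of the LASSO DEFECT on interior bond pairs (step F-d of the (P′1) roadmap)

statement-level skeleton of published theorems with citation tags; proofs where landed; nothing here is a claim about the Yang–Mills mass gap

THE PRINT.  (3.4)∕(3.8) pp. 391–392 (covariant curl and divergence), (3.40) p. 397 (transport along shortest contours), (3.69) p. 404 («Δ′ is a small perturbation of
D\*D»); [4] p. 248 (2.147) (the energy of the tent test functions).

WHY THIS FILE (dag-n06-i gen 14, N06 bundle F4, row 26).  The last displayed binder `hP1` of row 26 (certificate ed. 12) is the `Δ_a(U)`-energy of the transported tent
bumps; `B9Eq3132EnergyUpper` reduces it to `‖D_UA‖²`, `‖D\*_UA‖²`, `‖Q(U)A‖²_w` and the curvature edge mass, and `B9Eq3132TentCurl` computes `D_UA`, `D\*_UA` of ONE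
transported tent EXACTLY (flat differences of the profile, transported, plus lasso defects `R(W)X − X`).  THIS FILE turns those identities into ESTIMATES for one
tent with an arbitrary non-negative profile `θ` supported on the bonds issuing from a set `B`: the lasso defects are weighted by `θ(b)θ(b′)` for ADJACENT bonds, and
`θ(b)² ≤ (θ(b) − θ(b′))² + 2θ(b)θ(b′)` moves every boundary term into the flat gradient energy — so only INTERIOR lassos (both bonds issuing from `B`) need to be
small, and only plaquettes with three corners in `B` need a small curvature weight.  No geometry of [B9] is used here; the two smallness inputs are displayed (`ϑ`,
`w₁`) and discharged from (3.35) in the sequel.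

WHAT IS PROVED (sorry-free, 0 def; the currency — HS bookkeeping, `pdiff ∕ gradSq ∕ massSq` — is part 1, `B9Eq3132TentFlat`).
* §3 ★★★ `sum_hs_curlY_tentField_le` — `Σ_p HS(D_U(tent)(p)) ≤ c_f²·HS(X)·(20·gradSq θ + 64(d+1)ϑ²·massSq θ)` when every interior lasso is within `ϑ` of `1`.
* §4 ★★★ `sum_hs_divY_tentField_le` — `Σ_x HS(D\*_U(tent)(x)) ≤ (d+1)c_f²·HS(X)·(10·gradSq θ + 16ϑ²·massSq θ)`.
* §5 ★★ `sum_weight_edge_le` — `Σ_p w(p)Σ_m HS(tent(b_m p)) ≤ HS(X)·(w₀·gradSq θ + 4(d+1)w₁·massSq θ)` when `w ≤ w₀` everywhere and `w ≤ w₁` on plaquettes cornered in `B`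
  (needs the forward closure `θ⟨z,μ⟩ ≠ 0 ⇒ z + e_μ ∈ B`).

HONEST SCOPE.  Finite algebra and Cauchy–Schwarz over def-Y's letters; the smallness of lassos∕plaquettes is HYPOTHESIS here; nothing of [B9] asserted; count-neutral;
N06 NOT discharged.  Cell `pub-ymgap` (HUMAN RULING D-0062), Track A node N06 [B9], seat `pub-ymgap-dag-n06-i` (gen 14), 2026-08-27; a NEW file.
-/

noncomputable section

namespace Literature.MathematicalPhysics.QuantumFieldTheory.Balaban1983to89.B9Eq3132TentKinetic

open Node00
open B6KLevelCensusIndexV1 (KIdx)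
open B6GlobalChartV1 (PV)
open B9Eq39Adjoint (R R_add R_sub R_mul R_one R_smul R_zero)
open B9Ineq369CurvatureSmallAtLettersY (hs_nonneg hs_mul_left_le hs_mul_right_le hs_smul hs_add_le hs_sub_le hs_R_le contractive_of_mem_unitary)
open B9Thm311PosOfPrincipalAtLettersY (sum_edgeY_le)
open B9Eq3132TentCurl (tentField curlY_tentField divY_tentField)
open B9Thm311FlippedBondLetters (hs_real_smul)
open B9Eq3132TentFlat (hs_sum_le_card_mul hs_sum_le_card_support_mul hs_add_sub_le norm_inv_sub_one_le hs_R_sub_self_le hs_R_sub_self_le_four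
  sq_le_sq_sub_add sq_mul_defect_le pdiff gradSq massSq gradSq_nonneg massSq_nonneg sum_unshift sum_plaq_pdiff_sq_le sum_plaq_edge_sq_le)
open scoped Matrix Matrix.Norms.L2Operator

variable {N : ℕ}

/-! ## §3 ★★★ The covariant curl of one transported tent -/

section Curl

variable {d ℓ : ℕ} {hd : 1 ≤ d + 1} {hL : Odd (ℓ + 1) ∧ 1 < ℓ + 1} {b₀ b₁ : ℝ} (i : KIdx d ℓ hd hL b₀ b₁)

/-- members of the unitary group form contraction pairs. [cite: Balaban1985BackgroundPropagators, (3.3) p.391, bookkeeping] -/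
theorem contractive_of_mem {V : (Matrix (Fin N) (Fin N) ℂ)ˣ} (hV : V ∈ B7Prop2Explicit.unitaryUnits (Matrix (Fin N) (Fin N) ℂ)) :
    ‖(V : Matrix (Fin N) (Fin N) ℂ)‖ ≤ 1 ∧ ‖((V⁻¹ : (Matrix (Fin N) (Fin N) ℂ)ˣ) : Matrix (Fin N) (Fin N) ℂ)‖ ≤ 1 :=
  contractive_of_mem_unitary hV

variable {U : CfgY (Matrix (Fin N) (Fin N) ℂ) i} (hU : ∀ μ x, U μ x ∈ B7Prop2Explicit.unitaryUnits (Matrix (Fin N) (Fin N) ℂ))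
include hU

/-- the lassos are unitary. [cite: Balaban1985BackgroundPropagators, (3.40) p.397, bookkeeping] -/
theorem lasso_mem_unitary (x z : Site (PV d ℓ i.m i.K hd hL) 0) (κ : Fin (PV d ℓ i.m i.K hd hL).d) :
    parBY i U x z * U κ z * (parBY i U x (z.shift κ))⁻¹ ∈ B7Prop2Explicit.unitaryUnits (Matrix (Fin N) (Fin N) ℂ) :=
  Subgroup.mul_mem _ (Subgroup.mul_mem _ (parBY_mem i hU x z) (hU κ z)) (Subgroup.inv_mem _ (parBY_mem i hU x _))

/-- ★★ **PER PLAQUETTE**: with `z = x_p`, `θ₁ = θ⟨z,μ⟩, θ₂ = θ⟨z+e_μ,ν⟩, θ₃ = θ⟨z+e_ν,μ⟩, θ₄ = θ⟨z,ν⟩`,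
`HS(D_U(tent)(p)) ≤ c_f²·HS(X)·[20(θ₂−θ₄)² + 20(θ₃−θ₁)² + 16ϑ²(θ₁²+θ₂²+θ₃²+θ₄²)]` — interior lassos `ϑ`-small, boundary lassos absorbed by the differences.
[cite: Balaban1985BackgroundPropagators, (3.4) p.391, (3.40) p.397; Balaban1984PropagatorsII, (2.147) p.248] -/
theorem hs_curlY_tentField_le (θ : FBondY i → ℝ) (hθ : ∀ f, 0 ≤ θ f) (B : Finset (Site (PV d ℓ i.m i.K hd hL) 0)) (hB : ∀ f, θ f ≠ 0 → f.src ∈ B)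
    (x₀ : Site (PV d ℓ i.m i.K hd hL) 0) (X : Matrix (Fin N) (Fin N) ℂ) {ϑ : ℝ}
    (hW : ∀ (z : Site (PV d ℓ i.m i.K hd hL) 0) (κ : Fin (PV d ℓ i.m i.K hd hL).d), z ∈ B → z.shift κ ∈ B →
      ‖((parBY i U x₀ z * U κ z * (parBY i U x₀ (z.shift κ))⁻¹ : (Matrix (Fin N) (Fin N) ℂ)ˣ) : Matrix (Fin N) (Fin N) ℂ) - 1‖ ≤ ϑ) (p : PlaqY i) :
    ∑ a, ∑ b, ‖curlY i U (tentField i θ x₀ U X) p a b‖ ^ 2 ≤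
      i.cf ^ 2 * (∑ a, ∑ b, ‖X a b‖ ^ 2) *
        (20 * pdiff i θ p.μ ⟨p.src, p.ν⟩ ^ 2 + 20 * pdiff i θ p.ν ⟨p.src, p.μ⟩ ^ 2 +
          16 * ϑ ^ 2 * (θ ⟨p.src, p.μ⟩ ^ 2 + θ ⟨p.src.shift p.μ, p.ν⟩ ^ 2 + θ ⟨p.src.shift p.ν, p.μ⟩ ^ 2 + θ ⟨p.src, p.ν⟩ ^ 2)) := by
  -- the identity of `B9Eq3132TentCurl`
  rw [curlY_tentField, hs_real_smul, mul_assoc (i.cf ^ 2)]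
  refine mul_le_mul_of_nonneg_left (α := ℝ) ?_ (sq_nonneg _)
  set z := p.src
  set θ₁ := θ ⟨z, p.μ⟩
  set θ₂ := θ ⟨z.shift p.μ, p.ν⟩
  set θ₃ := θ ⟨z.shift p.ν, p.μ⟩
  set θ₄ := θ ⟨z, p.ν⟩
  set Wμ := parBY i U x₀ z * U p.μ z * (parBY i U x₀ (z.shift p.μ))⁻¹
  set Wν := parBY i U x₀ z * U p.ν z * (parBY i U x₀ (z.shift p.ν))⁻¹
  set hX := ∑ a, ∑ b, ‖X a b‖ ^ 2
  have hX0 : 0 ≤ hX := hs_nonneg X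
  have hτ := contractive_of_mem (Subgroup.inv_mem _ (parBY_mem i hU x₀ z))
  refine (hs_R_le hτ _).trans ?_
  refine (hs_add_sub_le _ _ _).trans ?_
  rw [hs_real_smul, hs_real_smul, hs_real_smul]
  -- the two lasso terms
  have hWμ := contractive_of_mem (lasso_mem_unitary i hU x₀ z p.μ)
  have hWν := contractive_of_mem (lasso_mem_unitary i hU x₀ z p.ν)
  have dμ := sq_mul_defect_le (a := θ₂) (b := θ₄) (ϑ := ϑ) (hθ _) (hθ _) hX0 (hs_nonneg _) (hs_R_sub_self_le_four hWμ X) fun h => by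
    have h2 : θ₂ ≠ 0 := fun e => h (by rw [e, zero_mul])
    have h4 : θ₄ ≠ 0 := fun e => h (by rw [e, mul_zero])
    exact hs_R_sub_self_le hWμ (hW z p.μ (hB _ h4) (hB _ h2)) X
  have dν := sq_mul_defect_le (a := θ₃) (b := θ₁) (ϑ := ϑ) (hθ _) (hθ _) hX0 (hs_nonneg _) (hs_R_sub_self_le_four hWν X) fun h => by
    have h3 : θ₃ ≠ 0 := fun e => h (by rw [e, zero_mul])
    have h1 : θ₁ ≠ 0 := fun e => h (by rw [e, mul_zero])
    exact hs_R_sub_self_le hWν (hW z p.ν (hB _ h1) (hB _ h3)) X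
  -- the flat part
  have hg : (θ₁ + θ₂ - θ₃ - θ₄) ^ 2 ≤ 2 * (θ₂ - θ₄) ^ 2 + 2 * (θ₃ - θ₁) ^ 2 := by nlinarith [sq_nonneg (θ₁ + θ₂ - θ₃ - θ₄), sq_nonneg ((θ₂ - θ₄) + (θ₃ - θ₁))]
  have e2 : pdiff i θ p.μ ⟨p.src, p.ν⟩ = θ₂ - θ₄ := rfl
  have e3 : pdiff i θ p.ν ⟨p.src, p.μ⟩ = θ₃ - θ₁ := rfl
  rw [e2, e3]
  nlinarith [mul_le_mul_of_nonneg_right hg hX0, sq_nonneg ϑ]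

/-- ★★★ **THE CURL OF ONE TRANSPORTED TENT**: `Σ_p HS((D_U tent)(p)) ≤ c_f²·HS(X)·(20·gradSq θ + 64(d+1)·ϑ²·massSq θ)` when every INTERIOR lasso
(`z, z+e_κ ∈ B`) is within `ϑ` of `1` — the flat gradient energy of the tree plus the lasso defects against the mass.
[cite: Balaban1985BackgroundPropagators, (3.4) p.391, (3.40) p.397, (3.69) p.404; Balaban1984PropagatorsII, (2.147) p.248] -/
theorem sum_hs_curlY_tentField_le (θ : FBondY i → ℝ) (hθ : ∀ f, 0 ≤ θ f) (B : Finset (Site (PV d ℓ i.m i.K hd hL) 0)) (hB : ∀ f, θ f ≠ 0 → f.src ∈ B)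
    (x₀ : Site (PV d ℓ i.m i.K hd hL) 0) (X : Matrix (Fin N) (Fin N) ℂ) {ϑ : ℝ}
    (hW : ∀ (z : Site (PV d ℓ i.m i.K hd hL) 0) (κ : Fin (PV d ℓ i.m i.K hd hL).d), z ∈ B → z.shift κ ∈ B →
      ‖((parBY i U x₀ z * U κ z * (parBY i U x₀ (z.shift κ))⁻¹ : (Matrix (Fin N) (Fin N) ℂ)ˣ) : Matrix (Fin N) (Fin N) ℂ) - 1‖ ≤ ϑ) :
    ∑ p : PlaqY i, ∑ a, ∑ b, ‖curlY i U (tentField i θ x₀ U X) p a b‖ ^ 2 ≤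
      i.cf ^ 2 * (∑ a, ∑ b, ‖X a b‖ ^ 2) * (20 * gradSq i θ + 64 * (d + 1) * ϑ ^ 2 * massSq i θ) := by
  refine (Finset.sum_le_sum fun p _ => hs_curlY_tentField_le i hU θ hθ B hB x₀ X hW p).trans ?_
  rw [← Finset.mul_sum]
  refine mul_le_mul_of_nonneg_left ?_ (mul_nonneg (sq_nonneg _) (hs_nonneg X))
  have h1 := sum_plaq_pdiff_sq_le i θ
  have h2 := sum_plaq_edge_sq_le i θ
  have e : ∑ p : PlaqY i, (20 * pdiff i θ p.μ ⟨p.src, p.ν⟩ ^ 2 + 20 * pdiff i θ p.ν ⟨p.src, p.μ⟩ ^ 2 +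
      16 * ϑ ^ 2 * (θ ⟨p.src, p.μ⟩ ^ 2 + θ ⟨p.src.shift p.μ, p.ν⟩ ^ 2 + θ ⟨p.src.shift p.ν, p.μ⟩ ^ 2 + θ ⟨p.src, p.ν⟩ ^ 2)) =
      20 * ∑ p : PlaqY i, (pdiff i θ p.μ ⟨p.src, p.ν⟩ ^ 2 + pdiff i θ p.ν ⟨p.src, p.μ⟩ ^ 2) +
        16 * ϑ ^ 2 * ∑ p : PlaqY i, (θ ⟨p.src, p.μ⟩ ^ 2 + θ ⟨p.src.shift p.μ, p.ν⟩ ^ 2 + θ ⟨p.src.shift p.ν, p.μ⟩ ^ 2 + θ ⟨p.src, p.ν⟩ ^ 2) := by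
    rw [Finset.mul_sum, Finset.mul_sum, ← Finset.sum_add_distrib]
    exact Finset.sum_congr rfl fun p _ => by ring
  rw [e]
  nlinarith [sq_nonneg ϑ, mul_le_mul_of_nonneg_left h2 (by positivity : (0 : ℝ) ≤ 16 * ϑ ^ 2)]

end Curl

/-! ## §4 ★★★ The covariant divergence of one transported tent -/

section Div

variable {d ℓ : ℕ} {hd : 1 ≤ d + 1} {hL : Odd (ℓ + 1) ∧ 1 < ℓ + 1} {b₀ b₁ : ℝ} (i : KIdx d ℓ hd hL b₀ b₁)
variable {U : CfgY (Matrix (Fin N) (Fin N) ℂ) i} (hU : ∀ μ x, U μ x ∈ B7Prop2Explicit.unitaryUnits (Matrix (Fin N) (Fin N) ℂ))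
include hU

/-- ★★ **PER SITE**: at the chart site over the torus site `x`, with `θ′_κ = θ⟨x−e_κ,κ⟩`, `θ″_κ = θ⟨x,κ⟩`,
`HS(D\*_U(tent)(x)) ≤ (d+1)c_f²·HS(X)·Σ_κ[10(θ′_κ − θ″_κ)² + 8ϑ²(θ′_κ² + θ″_κ²)]`. [cite: Balaban1985BackgroundPropagators, (3.8) p.392, (3.40) p.397; Balaban1984PropagatorsII, (2.147) p.248] -/
theorem hs_divY_tentField_le (θ : FBondY i → ℝ) (hθ : ∀ f, 0 ≤ θ f) (B : Finset (Site (PV d ℓ i.m i.K hd hL) 0)) (hB : ∀ f, θ f ≠ 0 → f.src ∈ B)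
    (x₀ : Site (PV d ℓ i.m i.K hd hL) 0) (X : Matrix (Fin N) (Fin N) ℂ) {ϑ : ℝ}
    (hW : ∀ (z : Site (PV d ℓ i.m i.K hd hL) 0) (κ : Fin (PV d ℓ i.m i.K hd hL).d), z ∈ B → z.shift κ ∈ B →
      ‖((parBY i U x₀ z * U κ z * (parBY i U x₀ (z.shift κ))⁻¹ : (Matrix (Fin N) (Fin N) ℂ)ˣ) : Matrix (Fin N) (Fin N) ℂ) - 1‖ ≤ ϑ) (s : SiteY i) :
    ∑ a, ∑ b, ‖divY i U (tentField i θ x₀ U X) s a b‖ ^ 2 ≤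
      ((d : ℝ) + 1) * i.cf ^ 2 * (∑ a, ∑ b, ‖X a b‖ ^ 2) *
        ∑ κ : Fin (PV d ℓ i.m i.K hd hL).d,
          (10 * pdiff i θ κ ⟨((B6GlobalChartV1.boxEquiv i.hN).symm s).unshift κ, κ⟩ ^ 2 +
            8 * ϑ ^ 2 * (θ ⟨((B6GlobalChartV1.boxEquiv i.hN).symm s).unshift κ, κ⟩ ^ 2 + θ ⟨(B6GlobalChartV1.boxEquiv i.hN).symm s, κ⟩ ^ 2)) := by
  rw [divY_tentField, hs_real_smul]
  set x := (B6GlobalChartV1.boxEquiv i.hN).symm s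
  set hX := ∑ a, ∑ b, ‖X a b‖ ^ 2
  have hX0 : 0 ≤ hX := hs_nonneg X
  have hτ := contractive_of_mem (Subgroup.inv_mem _ (parBY_mem i hU x₀ x))
  have hD : (((PV d ℓ i.m i.K hd hL).d : ℕ) : ℝ) = (d : ℝ) + 1 := by push_cast [show (PV d ℓ i.m i.K hd hL).d = d + 1 from rfl]; ring
  -- per direction
  have key : ∀ κ : Fin (PV d ℓ i.m i.K hd hL).d,
      ∑ a, ∑ b, ‖((((θ ⟨x.unshift κ, κ⟩ : ℝ)) : ℂ) • R (parBY i U x₀ (x.unshift κ) * U κ (x.unshift κ) * (parBY i U x₀ x)⁻¹)⁻¹ X -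
          (((θ ⟨x, κ⟩ : ℝ)) : ℂ) • X) a b‖ ^ 2 ≤
        hX * (10 * pdiff i θ κ ⟨x.unshift κ, κ⟩ ^ 2 + 8 * ϑ ^ 2 * (θ ⟨x.unshift κ, κ⟩ ^ 2 + θ ⟨x, κ⟩ ^ 2)) := by
    intro κ
    set θ' := θ ⟨x.unshift κ, κ⟩
    set θ'' := θ ⟨x, κ⟩
    set W := parBY i U x₀ (x.unshift κ) * U κ (x.unshift κ) * (parBY i U x₀ x)⁻¹
    have hWmem : W ∈ B7Prop2Explicit.unitaryUnits (Matrix (Fin N) (Fin N) ℂ) := by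
      have h := lasso_mem_unitary i hU x₀ (x.unshift κ) κ
      rwa [B10StarCount.shift_unshift] at h
    have hWi := contractive_of_mem (Subgroup.inv_mem _ hWmem)
    have e : (((θ' : ℝ)) : ℂ) • R W⁻¹ X - (((θ'' : ℝ)) : ℂ) • X = (((θ' : ℝ)) : ℂ) • (R W⁻¹ X - X) + ((((θ' - θ'') : ℝ)) : ℂ) • X := by
      push_cast; module
    rw [e]
    refine (hs_add_le _ _).trans ?_
    rw [hs_real_smul, hs_real_smul]
    have hd := sq_mul_defect_le (a := θ') (b := θ'') (ϑ := ϑ) (hθ _) (hθ _) hX0 (hs_nonneg _) (hs_R_sub_self_le_four hWi X) fun h => by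
      have h1 : θ' ≠ 0 := fun e => h (by rw [e, zero_mul])
      have h2 : θ'' ≠ 0 := fun e => h (by rw [e, mul_zero])
      have hz : x.unshift κ ∈ B := hB _ h1
      have hz' : (x.unshift κ).shift κ ∈ B := by rw [B10StarCount.shift_unshift]; exact hB _ h2
      have hb := hW _ κ hz hz'
      rw [B10StarCount.shift_unshift] at hb
      have := norm_inv_sub_one_le (V := W) (contractive_of_mem hWmem).2
      exact hs_R_sub_self_le hWi (this.trans hb) X
    have ep : pdiff i θ κ ⟨x.unshift κ, κ⟩ = θ'' - θ' := by
      show θ ⟨(x.unshift κ).shift κ, κ⟩ - θ ⟨x.unshift κ, κ⟩ = _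
      rw [B10StarCount.shift_unshift]
    rw [ep]
    nlinarith [sq_nonneg ϑ, sq_nonneg (θ' - θ'')]
  -- assemble over the directions
  refine le_trans (mul_le_mul_of_nonneg_left (α := ℝ) ((hs_R_le hτ _).trans (hs_sum_le_card_mul Finset.univ _)) (sq_nonneg _)) ?_
  rw [Finset.card_univ, Fintype.card_fin, hD]
  have hsum := Finset.sum_le_sum fun κ (_ : κ ∈ Finset.univ) => key κ
  rw [← Finset.mul_sum] at hsum
  calc i.cf ^ 2 * (((d : ℝ) + 1) * ∑ κ : Fin (PV d ℓ i.m i.K hd hL).d,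
        ∑ a, ∑ b, ‖((((θ ⟨x.unshift κ, κ⟩ : ℝ)) : ℂ) • R (parBY i U x₀ (x.unshift κ) * U κ (x.unshift κ) * (parBY i U x₀ x)⁻¹)⁻¹ X -
          (((θ ⟨x, κ⟩ : ℝ)) : ℂ) • X) a b‖ ^ 2)
      ≤ i.cf ^ 2 * (((d : ℝ) + 1) * (hX * ∑ κ : Fin (PV d ℓ i.m i.K hd hL).d,
          (10 * pdiff i θ κ ⟨x.unshift κ, κ⟩ ^ 2 + 8 * ϑ ^ 2 * (θ ⟨x.unshift κ, κ⟩ ^ 2 + θ ⟨x, κ⟩ ^ 2)))) := by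
        gcongr
    _ = _ := by ring

/-- ★★★ **THE DIVERGENCE OF ONE TRANSPORTED TENT**: `Σ_x HS((D\*_U tent)(x)) ≤ (d+1)c_f²·HS(X)·(10·gradSq θ + 16ϑ²·massSq θ)` when every interior lasso is
within `ϑ` of `1`. [cite: Balaban1985BackgroundPropagators, (3.8) p.392, (3.40) p.397; Balaban1984PropagatorsII, (2.147) p.248] -/
theorem sum_hs_divY_tentField_le (θ : FBondY i → ℝ) (hθ : ∀ f, 0 ≤ θ f) (B : Finset (Site (PV d ℓ i.m i.K hd hL) 0)) (hB : ∀ f, θ f ≠ 0 → f.src ∈ B)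
    (x₀ : Site (PV d ℓ i.m i.K hd hL) 0) (X : Matrix (Fin N) (Fin N) ℂ) {ϑ : ℝ}
    (hW : ∀ (z : Site (PV d ℓ i.m i.K hd hL) 0) (κ : Fin (PV d ℓ i.m i.K hd hL).d), z ∈ B → z.shift κ ∈ B →
      ‖((parBY i U x₀ z * U κ z * (parBY i U x₀ (z.shift κ))⁻¹ : (Matrix (Fin N) (Fin N) ℂ)ˣ) : Matrix (Fin N) (Fin N) ℂ) - 1‖ ≤ ϑ) :
    ∑ s : SiteY i, ∑ a, ∑ b, ‖divY i U (tentField i θ x₀ U X) s a b‖ ^ 2 ≤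
      ((d : ℝ) + 1) * i.cf ^ 2 * (∑ a, ∑ b, ‖X a b‖ ^ 2) * (10 * gradSq i θ + 16 * ϑ ^ 2 * massSq i θ) := by
  refine (Finset.sum_le_sum fun s _ => hs_divY_tentField_le i hU θ hθ B hB x₀ X hW s).trans ?_
  rw [← Finset.mul_sum]
  refine mul_le_mul_of_nonneg_left (α := ℝ) ?_ (by have := hs_nonneg X; positivity)
  -- pass to torus sites
  refine (Fintype.sum_equiv (B6GlobalChartV1.boxEquiv i.hN).symm _
    (fun x : Site (PV d ℓ i.m i.K hd hL) 0 => ∑ κ : Fin (PV d ℓ i.m i.K hd hL).d,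
      (10 * pdiff i θ κ ⟨x.unshift κ, κ⟩ ^ 2 + 8 * ϑ ^ 2 * (θ ⟨x.unshift κ, κ⟩ ^ 2 + θ ⟨x, κ⟩ ^ 2))) (fun _ => rfl)).trans_le ?_
  rw [Finset.sum_comm]
  -- reindex `x ↦ x − e_κ`
  have h1 : ∀ κ : Fin (PV d ℓ i.m i.K hd hL).d, ∑ x : Site (PV d ℓ i.m i.K hd hL) 0,
      (10 * pdiff i θ κ ⟨x.unshift κ, κ⟩ ^ 2 + 8 * ϑ ^ 2 * (θ ⟨x.unshift κ, κ⟩ ^ 2 + θ ⟨x, κ⟩ ^ 2)) =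
      ∑ w : Site (PV d ℓ i.m i.K hd hL) 0, (10 * pdiff i θ κ ⟨w, κ⟩ ^ 2 + 8 * ϑ ^ 2 * θ ⟨w, κ⟩ ^ 2) +
        ∑ x : Site (PV d ℓ i.m i.K hd hL) 0, 8 * ϑ ^ 2 * θ ⟨x, κ⟩ ^ 2 := by
    intro κ
    have hre : ∑ x : Site (PV d ℓ i.m i.K hd hL) 0, (10 * pdiff i θ κ ⟨x.unshift κ, κ⟩ ^ 2 + 8 * ϑ ^ 2 * θ ⟨x.unshift κ, κ⟩ ^ 2) =
        ∑ w : Site (PV d ℓ i.m i.K hd hL) 0, (10 * pdiff i θ κ ⟨w, κ⟩ ^ 2 + 8 * ϑ ^ 2 * θ ⟨w, κ⟩ ^ 2) :=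
      sum_unshift κ (fun w : Site (PV d ℓ i.m i.K hd hL) 0 => 10 * pdiff i θ κ ⟨w, κ⟩ ^ 2 + 8 * ϑ ^ 2 * θ ⟨w, κ⟩ ^ 2)
    rw [← hre, ← Finset.sum_add_distrib]
    exact Finset.sum_congr rfl fun x _ => by ring
  rw [Finset.sum_congr rfl fun κ _ => h1 κ, Finset.sum_add_distrib]
  -- identify with `gradSq`, `massSq`
  have hgrad : ∑ κ : Fin (PV d ℓ i.m i.K hd hL).d, ∑ w : Site (PV d ℓ i.m i.K hd hL) 0, pdiff i θ κ ⟨w, κ⟩ ^ 2 ≤ gradSq i θ := by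
    rw [Finset.sum_comm, gradSq, B10StarCount.sum_pbond]
    refine Finset.sum_le_sum fun w _ => Finset.sum_le_sum fun κ _ => ?_
    exact Finset.single_le_sum (f := fun ν => pdiff i θ ν ⟨w, κ⟩ ^ 2) (fun ν _ => sq_nonneg _) (Finset.mem_univ κ)
  have hmass : ∑ κ : Fin (PV d ℓ i.m i.K hd hL).d, ∑ w : Site (PV d ℓ i.m i.K hd hL) 0, θ ⟨w, κ⟩ ^ 2 = massSq i θ := by
    rw [Finset.sum_comm, massSq, B10StarCount.sum_pbond]
  have e1 : ∑ κ : Fin (PV d ℓ i.m i.K hd hL).d, ∑ w : Site (PV d ℓ i.m i.K hd hL) 0, (10 * pdiff i θ κ ⟨w, κ⟩ ^ 2 + 8 * ϑ ^ 2 * θ ⟨w, κ⟩ ^ 2) =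
      10 * ∑ κ : Fin (PV d ℓ i.m i.K hd hL).d, ∑ w : Site (PV d ℓ i.m i.K hd hL) 0, pdiff i θ κ ⟨w, κ⟩ ^ 2 +
        8 * ϑ ^ 2 * ∑ κ : Fin (PV d ℓ i.m i.K hd hL).d, ∑ w : Site (PV d ℓ i.m i.K hd hL) 0, θ ⟨w, κ⟩ ^ 2 := by
    rw [Finset.mul_sum, Finset.mul_sum, ← Finset.sum_add_distrib]
    refine Finset.sum_congr rfl fun κ _ => ?_
    rw [Finset.mul_sum, Finset.mul_sum, ← Finset.sum_add_distrib]
  have e2 : ∑ κ : Fin (PV d ℓ i.m i.K hd hL).d, ∑ x : Site (PV d ℓ i.m i.K hd hL) 0, 8 * ϑ ^ 2 * θ ⟨x, κ⟩ ^ 2 =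
      8 * ϑ ^ 2 * ∑ κ : Fin (PV d ℓ i.m i.K hd hL).d, ∑ w : Site (PV d ℓ i.m i.K hd hL) 0, θ ⟨w, κ⟩ ^ 2 := by
    rw [Finset.mul_sum]
    exact Finset.sum_congr rfl fun κ _ => by rw [Finset.mul_sum]
  rw [e1, e2, hmass]
  nlinarith [sq_nonneg ϑ, massSq_nonneg i θ]

end Div

/-! ## §5 ★★ The curvature-weighted edge mass of one transported tent -/

section Edge

variable {d ℓ : ℕ} {hd : 1 ≤ d + 1} {hL : Odd (ℓ + 1) ∧ 1 < ℓ + 1} {b₀ b₁ : ℝ} (i : KIdx d ℓ hd hL b₀ b₁)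
variable {U : CfgY (Matrix (Fin N) (Fin N) ℂ) i} (hU : ∀ μ x, U μ x ∈ B7Prop2Explicit.unitaryUnits (Matrix (Fin N) (Fin N) ℂ))
include hU

/-- one tent value costs `θ(b)²·HS(X)`. [cite: Balaban1985BackgroundPropagators, (3.13) p.393, bookkeeping] -/
theorem hs_tentField_le (θ : FBondY i → ℝ) (x₀ : Site (PV d ℓ i.m i.K hd hL) 0) (X : Matrix (Fin N) (Fin N) ℂ) (b : FBondY i) :
    ∑ a, ∑ c, ‖tentField i θ x₀ U X b a c‖ ^ 2 ≤ θ b ^ 2 * ∑ a, ∑ c, ‖X a c‖ ^ 2 := by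
  rw [tentField, hs_real_smul]
  exact mul_le_mul_of_nonneg_left (hs_R_le (contractive_of_mem (Subgroup.inv_mem _ (parBY_mem i hU x₀ _))) X) (sq_nonneg _)

/-- ★★ **THE WEIGHTED EDGE MASS**: for weights `0 ≤ w(p) ≤ w₀`, with `w(p) ≤ w₁` whenever the three corners `x_p, x_p+e_μ, x_p+e_ν` lie in `B`, and a profile
supported on bonds issuing from `B` and FORWARD-CLOSED (`θ⟨z,μ⟩ ≠ 0 ⇒ z+e_μ ∈ B`):
`Σ_p w(p)·Σ_{m<4} HS(tent(b_m p)) ≤ HS(X)·(w₀·gradSq θ + 4(d+1)·w₁·massSq θ)` — the products `θ(b)θ(b′)` of parallel edges force the plaquette into `B`.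
[cite: Balaban1985BackgroundPropagators, (3.69) p.404, (3.10) p.392; Balaban1984PropagatorsII, (2.147) p.248] -/
theorem sum_weight_edge_le (θ : FBondY i → ℝ) (hθ : ∀ f, 0 ≤ θ f) (B : Finset (Site (PV d ℓ i.m i.K hd hL) 0)) (hB : ∀ f, θ f ≠ 0 → f.src ∈ B)
    (hfwd : ∀ f : FBondY i, θ f ≠ 0 → f.src.shift f.dir ∈ B) (x₀ : Site (PV d ℓ i.m i.K hd hL) 0) (X : Matrix (Fin N) (Fin N) ℂ)
    (w : PlaqY i → ℝ) {w₀ w₁ : ℝ} (hw0 : ∀ p, 0 ≤ w p) (hw₀ : ∀ p, w p ≤ w₀)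
    (hw₁ : ∀ p : PlaqY i, p.src ∈ B → p.src.shift p.μ ∈ B → p.src.shift p.ν ∈ B → w p ≤ w₁) (hw₀0 : 0 ≤ w₀) (hw₁0 : 0 ≤ w₁) :
    ∑ p : PlaqY i, w p * ∑ m : Fin 4, ∑ a, ∑ c, ‖tentField i θ x₀ U X (edgeY i p m) a c‖ ^ 2 ≤
      (∑ a, ∑ c, ‖X a c‖ ^ 2) * (w₀ * gradSq i θ + 4 * (d + 1) * w₁ * massSq i θ) := by
  set hX := ∑ a, ∑ c, ‖X a c‖ ^ 2
  have hX0 : 0 ≤ hX := hs_nonneg X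
  -- per plaquette
  have key : ∀ p : PlaqY i, w p * ∑ m : Fin 4, ∑ a, ∑ c, ‖tentField i θ x₀ U X (edgeY i p m) a c‖ ^ 2 ≤
      hX * (w₀ * (pdiff i θ p.μ ⟨p.src, p.ν⟩ ^ 2 + pdiff i θ p.ν ⟨p.src, p.μ⟩ ^ 2) +
        w₁ * (θ ⟨p.src, p.μ⟩ ^ 2 + θ ⟨p.src.shift p.μ, p.ν⟩ ^ 2 + θ ⟨p.src.shift p.ν, p.μ⟩ ^ 2 + θ ⟨p.src, p.ν⟩ ^ 2)) := by
    intro p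
    set z := p.src
    set θ₁ := θ ⟨z, p.μ⟩
    set θ₂ := θ ⟨z.shift p.μ, p.ν⟩
    set θ₃ := θ ⟨z.shift p.ν, p.μ⟩
    set θ₄ := θ ⟨z, p.ν⟩
    have e0 : edgeY i p 0 = ⟨z.shift p.ν, p.μ⟩ := rfl
    have e1 : edgeY i p 1 = ⟨z, p.ν⟩ := rfl
    have e2 : edgeY i p 2 = ⟨z, p.μ⟩ := rfl
    have e3 : edgeY i p 3 = ⟨z.shift p.μ, p.ν⟩ := rfl
    have hedges : ∑ m : Fin 4, ∑ a, ∑ c, ‖tentField i θ x₀ U X (edgeY i p m) a c‖ ^ 2 ≤ (θ₁ ^ 2 + θ₂ ^ 2 + θ₃ ^ 2 + θ₄ ^ 2) * hX := by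
      rw [Fin.sum_univ_four, e0, e1, e2, e3]
      have := hs_tentField_le i hU θ x₀ X ⟨z.shift p.ν, p.μ⟩
      have := hs_tentField_le i hU θ x₀ X ⟨z, p.ν⟩
      have := hs_tentField_le i hU θ x₀ X ⟨z, p.μ⟩
      have := hs_tentField_le i hU θ x₀ X ⟨z.shift p.μ, p.ν⟩
      linarith
    have ep2 : pdiff i θ p.μ ⟨p.src, p.ν⟩ = θ₂ - θ₄ := rfl
    have ep3 : pdiff i θ p.ν ⟨p.src, p.μ⟩ = θ₃ - θ₁ := rfl
    rw [ep2, ep3]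
    -- the two products of parallel edges
    have hp24 : w p * (2 * (θ₂ * θ₄)) ≤ w₁ * (θ₂ ^ 2 + θ₄ ^ 2) := by
      by_cases h : θ₂ * θ₄ = 0
      · rw [h, mul_zero, mul_zero]; positivity
      · have h2 : θ₂ ≠ 0 := fun e => h (by rw [e, zero_mul])
        have h4 : θ₄ ≠ 0 := fun e => h (by rw [e, mul_zero])
        have hwp : w p ≤ w₁ := hw₁ p (hB _ h4) (hB _ h2) (hfwd ⟨z, p.ν⟩ h4)
        have hab : 0 ≤ 2 * (θ₂ * θ₄) := by have := hθ ⟨z.shift p.μ, p.ν⟩; have := hθ ⟨z, p.ν⟩; positivity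
        calc w p * (2 * (θ₂ * θ₄)) ≤ w₁ * (2 * (θ₂ * θ₄)) := mul_le_mul_of_nonneg_right hwp hab
          _ ≤ w₁ * (θ₂ ^ 2 + θ₄ ^ 2) := mul_le_mul_of_nonneg_left (by nlinarith [sq_nonneg (θ₂ - θ₄)]) hw₁0
    have hp13 : w p * (2 * (θ₃ * θ₁)) ≤ w₁ * (θ₁ ^ 2 + θ₃ ^ 2) := by
      by_cases h : θ₃ * θ₁ = 0
      · rw [h, mul_zero, mul_zero]; positivity
      · have h3 : θ₃ ≠ 0 := fun e => h (by rw [e, zero_mul])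
        have h1 : θ₁ ≠ 0 := fun e => h (by rw [e, mul_zero])
        have hwp : w p ≤ w₁ := hw₁ p (hB _ h1) (hfwd ⟨z, p.μ⟩ h1) (hB _ h3)
        have hab : 0 ≤ 2 * (θ₃ * θ₁) := by have := hθ ⟨z.shift p.ν, p.μ⟩; have := hθ ⟨z, p.μ⟩; positivity
        calc w p * (2 * (θ₃ * θ₁)) ≤ w₁ * (2 * (θ₃ * θ₁)) := mul_le_mul_of_nonneg_right hwp hab
          _ ≤ w₁ * (θ₁ ^ 2 + θ₃ ^ 2) := mul_le_mul_of_nonneg_left (by nlinarith [sq_nonneg (θ₃ - θ₁)]) hw₁0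
    have hsq : θ₁ ^ 2 + θ₂ ^ 2 + θ₃ ^ 2 + θ₄ ^ 2 = (θ₂ - θ₄) ^ 2 + (θ₃ - θ₁) ^ 2 + 2 * (θ₂ * θ₄) + 2 * (θ₃ * θ₁) := by ring
    have hwd : w p * ((θ₂ - θ₄) ^ 2 + (θ₃ - θ₁) ^ 2) ≤ w₀ * ((θ₂ - θ₄) ^ 2 + (θ₃ - θ₁) ^ 2) :=
      mul_le_mul_of_nonneg_right (hw₀ p) (by positivity)
    calc w p * ∑ m : Fin 4, ∑ a, ∑ c, ‖tentField i θ x₀ U X (edgeY i p m) a c‖ ^ 2 ≤ w p * ((θ₁ ^ 2 + θ₂ ^ 2 + θ₃ ^ 2 + θ₄ ^ 2) * hX) :=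
          mul_le_mul_of_nonneg_left hedges (hw0 p)
      _ = hX * (w p * ((θ₂ - θ₄) ^ 2 + (θ₃ - θ₁) ^ 2) + w p * (2 * (θ₂ * θ₄)) + w p * (2 * (θ₃ * θ₁))) := by rw [hsq]; ring
      _ ≤ hX * (w₀ * ((θ₂ - θ₄) ^ 2 + (θ₃ - θ₁) ^ 2) + w₁ * (θ₂ ^ 2 + θ₄ ^ 2) + w₁ * (θ₁ ^ 2 + θ₃ ^ 2)) :=
          mul_le_mul_of_nonneg_left (by linarith) hX0
      _ = _ := by ring
  refine (Finset.sum_le_sum fun p _ => key p).trans ?_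
  rw [← Finset.mul_sum]
  refine mul_le_mul_of_nonneg_left (α := ℝ) ?_ hX0
  rw [Finset.sum_add_distrib, ← Finset.mul_sum, ← Finset.mul_sum]
  have h1 := sum_plaq_pdiff_sq_le i θ
  have h2 := sum_plaq_edge_sq_le i θ
  nlinarith [mul_le_mul_of_nonneg_left h1 hw₀0, mul_le_mul_of_nonneg_left h2 hw₁0]

end Edge

end Literature.MathematicalPhysics.QuantumFieldTheory.Balaban1983to89.B9Eq3132TentKinetic

end
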